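import Mathlib
import Literature.Barriers.PneNP.MatchingSlackPsdApproximation
import Literature.Combinatorics.Optimization.PsdFactorizationRescaling
import HarnessLib

/-!
# Tracial hyperplane separation with multilevel extrapolation designs (psd rank of the matching slack)

Vocabulary only (definitions, no facts asserted; one kernel-checked composition lemma). The
NONCOMMUTATIVE (tracial) form of Rothvoß's hyperplane-separation lower bound for the odd-cut slack matrix
`pmOddCutSlack n (U, M) = |δ(U) ∩ M| − 1` of the perfect matching polytope
[cite: Rothvoss2017, §2 (PDF pp. 5–7)], at the level of psd FACTORIZATIONS
(`Literature.Combinatorics.Optimization.HasPsdFactorization`):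

* PSD RECTANGLES `IsPsdRect X Y` — `0 ⪯ X_U ⪯ I`, `0 ⪯ Y_M ⪯ I`, `X_U Y_M = 0` on the tight pairs
  `|δ(U) ∩ M| = 1` — the objects a size-`r` psd factorization of a slack matrix with entries in `[0, Δ]`
  becomes after the Briët–Dadush–Pokutta rescaling `‖A_U‖, ‖B_M‖ ≤ √(rΔ)`
  [cite: BrietDadushPokutta2014, Thm. 6 (§3)]; their normalised-trace VALUE against a weight matrix `W`,
  `TracialValueLEAt W γ r`, is what a tracial (noncommutative-polynomial) certificate bounds
  [cite: GriblingDelaatLaurent2019, §5]; and the resulting HYPERPLANE BOUND at the dimension of the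
  factorization with polynomial loss, `TracialHyperplaneBoundAt` (`⟨W, S⟩ ≤ r^p·Δ·γ`; `p = 2` in print), the psd
  analogue of Rothvoß's
  `xc ≥ ⟨W,S⟩ / (‖S‖_∞ · max_R ⟨W,R⟩)` [cite: Rothvoss2017, §2 (PDF pp. 6–7)].
* MULTILEVEL PLANTED WEIGHTS `levelWeight n t C w = Σ_{c ∈ C} w_c · μ_{Q_c(t)}` on Rothvoß's level classes
  `Q_c(t) = {(U, M) : |U| = t, |δ(U) ∩ M| = c}` [cite: Rothvoss2017, §2 (PDF p. 6)] (Rothvoß: `C = {3, k}`,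
  `w = (1, −1/(k−1))`), their LEVEL PROFILE `levelProfile` of a psd rectangle, and EXACT EXTRAPOLATION
  DESIGNS `IsExactDesign n t T D B C w`: profiles `w` on the odd levels `3 ≤ c ≤ T` that extrapolate every
  polynomial of degree `≤ D` to the parity-forbidden virtual level `c = 0` (`Σ_c w_c p(c) = −p(0)`), with
  total variation `Σ_c |w_c| ≤ B` — bounded variation being available exactly in the Chebyshev regime
  `D² ≲ T` of polynomial growth at equally spaced points [cite: CoppersmithRivlin1992, Thm. (p. 970)];
  the parameters used are `D = dq n ≍ n^{1/4}`, `T = Tq n ≍ n^{1/2}` on BALANCED cuts `n/4 ≤ t < n/2`.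
* The statements built from them: design existence `ChebyshevDesignExistsBal B`, the dimension-restricted
  TRACIAL DECAY `TracialDecayDimBal a B` (value `≤ n^{−a·D}` on psd rectangles of every dimension `r` with
  `r²·n < n^{a·D}`), its classical `r = 1` shadow `RectangleDecayBal a B` (Rothvoß's rectangle lemma
  [cite: Rothvoss2017, Lemma 6 and Lemma 7 (PDF pp. 6–8)] is the two-level, `r = 1` instance of this shape),
  and the conclusions `MultilevelTracialBoundDim f` / `ExpTracialBoundDim` consumed by the hyperplane bound.

Typed verbatim from cell pnp-psdrank's kernel-checked sketch (pnp-psdrank-p1 `Sketch.lean` v9, §v8–v9;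
referee typing audit "exponential-typed: YES (stretched, `2^{n^{1/4}}` scale)" 2026-08-25); consumers: the
rung leaf `Summit.PneNP.MatchingPsdRank.MatchingPsdRankStretchedExp` and the items of its D-0059 route
`ChebyshevTracialDesign`. No decay statement here is asserted — they are route items (open conjectures of
the cell), defined as `Prop`s to be used as hypotheses.
-/

noncomputable section

open Finset Matrix

namespace Literature.Combinatorics.Optimization

open Literature.Barriers.PneNP

/-! ### Psd rectangles, tracial value, the hyperplane bound at a dimension -/

/-- A **psd rectangle of dimension `r` avoiding the tight pairs** on (odd sets) × (perfect matchings) of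
`K_n`: `0 ⪯ X_U ⪯ I`, `0 ⪯ Y_M ⪯ I`, and `X_U * Y_M = 0` whenever `|δ(U) ∩ M| = 1` (the rescaled,
normalised factors of a psd factorization of a slack matrix vanishing on the tight pairs: `tr(A_U B_M) = 0`
with `A_U, B_M ⪰ 0` forces `A_U B_M = 0`). For `r = 1` these are the fractional rectangles avoiding `Q_1`.
[cite: BrietDadushPokutta2014, Thm. 6 (§3)] -/
def IsPsdRect {n r : ℕ} (X : OddSet n → Matrix (Fin r) (Fin r) ℝ)
    (Y : PMatch n → Matrix (Fin r) (Fin r) ℝ) : Prop :=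
  (∀ U, (X U).PosSemidef ∧ (1 - X U).PosSemidef) ∧
  (∀ M, (Y M).PosSemidef ∧ (1 - Y M).PosSemidef) ∧
  ∀ U M, cc U M = 1 → X U * Y M = 0

/-- `TracialValueLEAt W γ r`: the normalised-trace value `(1/r) Σ_{U,M} W(U,M) tr(X_U Y_M)` of the weight
matrix `W` is `≤ γ` on every psd rectangle of dimension `r` (the quantity bounded by a tracial /
noncommutative-polynomial certificate evaluated in dimension `r`). [cite: GriblingDelaatLaurent2019, §5] -/
def TracialValueLEAt {n : ℕ} (W : OddSet n → PMatch n → ℝ) (γ : ℝ) (r : ℕ) : Prop :=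
  ∀ (X : OddSet n → Matrix (Fin r) (Fin r) ℝ) (Y : PMatch n → Matrix (Fin r) (Fin r) ℝ),
    IsPsdRect X Y → (∑ U, ∑ M, W U M * (X U * Y M).trace) / r ≤ γ

/-- **Tracial hyperplane bound at the dimension of the factorization, with polynomial loss** (named
statement, used as a hypothesis): for some exponent `p`, whenever `S ≤ Δ` entrywise (`0 ≤ Δ`; `S ≥ 0` is
automatic from the factorization, `tr(A_U B_M) ≥ 0`) vanishes on the tight pairs and has a psd factorization
of size `r`, every weight matrix `W` of tracial value `≤ γ` in dimension `r` has `⟨W, S⟩ ≤ r^p·Δ·γ`. With `p = 2` this is the Briët–Dadush–Pokutta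
rescaling (factors of operator norm `≤ √(rΔ)`, via John's theorem) [cite: BrietDadushPokutta2014, Thm. 6 (§3)];
an elementary Auerbach-basis rescaling gives `p = 3`; any polynomial loss in `r` is absorbed by the
stretched-exponential assembly. The hypothesis `0 ≤ Δ` is needed: for `n = 0` or odd `n` one index type is
empty and the entry bounds are vacuous. Psd analogue of Rothvoß's `xc ≥ ⟨W,S⟩ / (‖S‖_∞ · max_R ⟨W,R⟩)`
[cite: Rothvoss2017, §2 (PDF pp. 6–7)]. -/
def TracialHyperplaneBoundAt : Prop :=
  ∃ p : ℕ, ∀ (n r : ℕ) (S W : OddSet n → PMatch n → ℝ) (Δ γ : ℝ), 0 ≤ Δ →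
    (∀ U M, S U M ≤ Δ) → (∀ U M, cc U M = 1 → S U M = 0) →
    TracialValueLEAt W γ r → HasPsdFactorization S r →
      (∑ U, ∑ M, W U M * S U M) ≤ (r : ℝ) ^ p * Δ * γ

/-! ### Multilevel planted weights and level profiles -/

/-- **Multilevel planted weight** on the `t`-cuts: `W(U,M) = Σ_{c ∈ C} w_c · 1[(U,M) ∈ Q_c(t)] / |Q_c(t)|`
(`Qset n t c` = pairs with `|U| = t`, `|δ(U) ∩ M| = c`). Rothvoß's weight is `C = {3, k}`, `w_3 = 1`,
`w_k = −1/(k−1)`. [cite: Rothvoss2017, §2 (PDF p. 6, eq. (2))] -/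
def levelWeight (n t : ℕ) (C : Finset ℕ) (w : ℕ → ℝ) : OddSet n → PMatch n → ℝ :=
  fun U M => ∑ c ∈ C, if (U, M) ∈ Qset n t c then w c / ((Qset n t c).card : ℝ) else 0

/-- **Level profile** of a psd rectangle of dimension `r` on the `t`-cuts: `Φ(c) = E_{(U,M) ∈ Q_c(t)} tr(X_U Y_M) / r`
(for `r = 1` and 0/1 rectangles this is Rothvoß's `μ_c(X × Y)`). [cite: Rothvoss2017, §2 (PDF p. 6)] -/
def levelProfile (n t r : ℕ) (X : OddSet n → Matrix (Fin r) (Fin r) ℝ)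
    (Y : PMatch n → Matrix (Fin r) (Fin r) ℝ) (c : ℕ) : ℝ :=
  (∑ q ∈ Qset n t c, (X q.1 * Y q.2).trace) / ((r : ℝ) * ((Qset n t c).card : ℝ))

/-! ### Exact extrapolation designs in the Chebyshev regime -/

/-- Exactness degree parameter `D(n) = ⌊⌊√n⌋^{1/2}⌋ ≍ n^{1/4}` (so that `D(n)² ≤ T(n)/4`, the regime of
bounded polynomial growth at equally spaced points). [cite: CoppersmithRivlin1992, Thm. (p. 970)] -/
def dq (n : ℕ) : ℕ := Nat.sqrt (Nat.sqrt n)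

/-- Top planted level `T(n) = 4⌊√n⌋ + 3 ≍ n^{1/2}`. [cite: CoppersmithRivlin1992, Thm. (p. 970)] -/
def Tq (n : ℕ) : ℕ := 4 * Nat.sqrt n + 3

/-- An **exact extrapolation design** of degree `D` on odd levels `3 ≤ c ≤ T` for the `t`-cuts of `K_n`
(`t` odd, `2t + 2 ≤ n`, `T ≤ t`, every used level class nonempty): normalised (`Σ_c w_c (c − 1) = 1`, i.e.
`⟨W, S⟩ = 1` by double counting [cite: Rothvoss2017, §2 (PDF p. 6, eq. (2))]), exact at the virtual level
`c = 0` for all polynomials of degree `≤ D` (`Σ_c w_c p(c) = −p(0)`), of total variation `Σ_c |w_c| ≤ B`.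
[cite: CoppersmithRivlin1992, Thm. (p. 970)] -/
def IsExactDesign (n t T D : ℕ) (B : ℝ) (C : Finset ℕ) (w : ℕ → ℝ) : Prop :=
  Odd t ∧ 2 * t + 2 ≤ n ∧ T ≤ t ∧
  (∀ c ∈ C, Odd c ∧ 3 ≤ c ∧ c ≤ T ∧ (Qset n t c).Nonempty) ∧
  (∑ c ∈ C, w c * ((c : ℝ) - 1) = 1) ∧
  (∀ p : Polynomial ℝ, p.natDegree ≤ D → ∑ c ∈ C, w c * p.eval (c : ℝ) = -p.eval 0) ∧
  (∑ c ∈ C, |w c| ≤ B)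

/-- A **balanced** exact design: an exact design on `t`-cuts with `n ≤ 4t` (Rothvoß's cuts are balanced,
`t ≈ n/2`). [cite: Rothvoss2017, §2 (PDF p. 6)] -/
def IsBalancedDesign (n t T D : ℕ) (B : ℝ) (C : Finset ℕ) (w : ℕ → ℝ) : Prop :=
  IsExactDesign n t T D B C w ∧ n ≤ 4 * t

/-- **Chebyshev design existence** with variation bound `B`: for all large even `n` there is a balanced exact
design of degree `dq n` on levels `≤ Tq n`. (Approximation theory in the regime `D² ≤ T/4`; the cell's
kit-certified table has `Σ|w| ≤ 16.2` up to `T = 403` at `D²/T ≈ 1`.) [cite: CoppersmithRivlin1992, Thm. (p. 970)] -/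
def ChebyshevDesignExistsBal (B : ℝ) : Prop :=
  ∃ n₀ : ℕ, ∀ n : ℕ, n₀ ≤ n → Even n →
    ∃ (t : ℕ) (C : Finset ℕ) (w : ℕ → ℝ), IsBalancedDesign n t (Tq n) (dq n) B C w

/-! ### Decay statements (route items; nothing asserted) -/

/-- **Dimension-restricted tracial decay for balanced Chebyshev designs** (exponent `a`, variation `B`): for
all large even `n`, every balanced exact design of degree `dq n` on levels `≤ Tq n` with `Σ|w| ≤ B` has
tracial value `≤ n^{−a·dq n}` on psd rectangles of every dimension `r` with `r²·n < n^{a·dq n}` — exactly what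
`TracialHyperplaneBoundAt` consumes to exclude factorizations of dimension `r`. The `r = 1`, two-level
instance of this shape is Rothvoß's rectangle lemma. [cite: Rothvoss2017, Lemma 6 and Lemma 7 (PDF pp. 6–8)]
[cite: GriblingDelaatLaurent2019, §5] -/
def TracialDecayDimBal (a B : ℝ) : Prop :=
  ∃ n₁ : ℕ, ∀ n : ℕ, n₁ ≤ n → Even n → ∀ (t : ℕ) (C : Finset ℕ) (w : ℕ → ℝ),
    IsBalancedDesign n t (Tq n) (dq n) B C w →
      ∀ r : ℕ, 0 < r → (r : ℝ) ^ 2 * n < (n : ℝ) ^ (a * (dq n : ℝ)) →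
        TracialValueLEAt (levelWeight n t C w) ((n : ℝ) ^ (-(a * (dq n : ℝ)))) r

/-- The classical (`r = 1`, 0/1-rectangle) shadow of `TracialDecayDimBal`: every rectangle `X × Y` avoiding
`Q_1` has `Σ_{X × Y} W ≤ n^{−a·dq n}`. [cite: Rothvoss2017, Lemma 6 and Lemma 7 (PDF pp. 6–8)] -/
def RectangleDecayBal (a B : ℝ) : Prop :=
  ∃ n₁ : ℕ, ∀ n : ℕ, n₁ ≤ n → Even n → ∀ (t : ℕ) (C : Finset ℕ) (w : ℕ → ℝ),
    IsBalancedDesign n t (Tq n) (dq n) B C w →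
    ∀ (X : Finset (OddSet n)) (Y : Finset (PMatch n)), (∀ U ∈ X, ∀ M ∈ Y, cc U M ≠ 1) →
      ∑ U ∈ X, ∑ M ∈ Y, levelWeight n t C w U M ≤ (n : ℝ) ^ (-(a * (dq n : ℝ)))

/-- **Multilevel tracial bound, dimension-restricted** with exponent profile `f`: for all large even `n` there
are a cut size `t`, nonempty levels `C` and a normalised profile `w` (`Σ_c w_c (c − 1) = 1`) whose multilevel
weight has tracial value `≤ n^{−f(n)}` on psd rectangles of every dimension `r` with `r²·n < n^{f(n)}`.
[cite: GriblingDelaatLaurent2019, §5] [cite: Rothvoss2017, §2 (PDF pp. 6–7)] -/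
def MultilevelTracialBoundDim (f : ℕ → ℝ) : Prop :=
  ∃ n₀ : ℕ, ∀ n : ℕ, n₀ ≤ n → Even n →
    ∃ (t : ℕ) (C : Finset ℕ) (w : ℕ → ℝ),
      (∀ c ∈ C, (Qset n t c).Nonempty) ∧ (∑ c ∈ C, w c * ((c : ℝ) - 1) = 1) ∧
      ∀ r : ℕ, 0 < r → (r : ℝ) ^ 2 * n < (n : ℝ) ^ (f n) →
        TracialValueLEAt (levelWeight n t C w) ((n : ℝ) ^ (-(f n))) r

/-- The stretched-exponential instance: exponent profile `f(n) = a · dq n ≍ a·n^{1/4}` for some `a > 0`.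
[cite: GriblingDelaatLaurent2019, §5] -/
def ExpTracialBoundDim : Prop :=
  ∃ a : ℝ, 0 < a ∧ MultilevelTracialBoundDim (fun n => a * (dq n : ℝ))

/-- Composition (pure logic, the shape of Rothvoß's §2 assembly "planted weights + rectangle lemma ⇒ bound"):
design existence and tracial decay for the same variation bound `B` give the stretched-exponential multilevel
tracial bound. [cite: Rothvoss2017, §2 (PDF pp. 6–8)] -/
theorem expTracialBoundDim_of_bal (B a : ℝ) (ha : 0 < a)
    (hA : ChebyshevDesignExistsBal B) (hB : TracialDecayDimBal a B) : ExpTracialBoundDim := by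
  obtain ⟨n₀, h₀⟩ := hA
  obtain ⟨n₁, h₁⟩ := hB
  refine ⟨a, ha, max n₀ n₁, fun n hn hev => ?_⟩
  obtain ⟨t, C, w, hdes⟩ := h₀ n (le_trans (le_max_left _ _) hn) hev
  refine ⟨t, C, w, fun c hc => (hdes.1.2.2.2.1 c hc).2.2.2, hdes.1.2.2.2.2.1, ?_⟩
  exact h₁ n (le_trans (le_max_right _ _) hn) hev t C w hdes

/-! ### Discharge of the hyperplane bound (appended 2026-08-25) -/

/-- **The tracial hyperplane bound holds, with loss exponent `p = 3`**: by the weak (Auerbach-basis) form of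
the Briët–Dadush–Pokutta rescaling, `Literature.Combinatorics.Optimization.HasPsdFactorization.rescale_weak`
/ `….weightedSum_le_of_psdRect` — a size-`r` psd factorization of `S ≤ Δ` gives `S = r²Δ·tr(X_U Y_M)` with
`0 ⪯ X, Y ⪯ I` and `X_U Y_M = 0` wherever `S = 0` (in particular on the tight pairs), whence
`⟨W, S⟩ ≤ r²Δ · (r γ)`. (`p = 2` is the printed constant, via John's theorem.)
[cite: BrietDadushPokutta2014, Thm. 6 (§3)] [cite: Rothvoss2017, §2 (PDF pp. 6–7)] -/
theorem tracialHyperplaneBoundAt_holds : TracialHyperplaneBoundAt := by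
  refine ⟨3, fun n r S W Δ γ hΔ hS hcc hW hfac => ?_⟩
  refine HasPsdFactorization.weightedSum_le_of_psdRect hΔ hS hfac fun X Y hX hY hzero => ?_
  have hrect : IsPsdRect X Y := ⟨hX, hY, fun U M h1 => hzero U M (hcc U M h1)⟩
  have h := hW X Y hrect
  rcases Nat.eq_zero_or_pos r with rfl | hr
  · simp [Matrix.trace]
  · have hr' : (0 : ℝ) < r := by exact_mod_cast hr
    calc ∑ U, ∑ M, W U M * (X U * Y M).trace ≤ γ * r := (div_le_iff₀ hr').1 h
      _ = r * γ := mul_comm _ _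

end Literature.Combinatorics.Optimization

end
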